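import Summits.BirchSwinnertonDyer.Rank1Residual.X10.BeyondCarrierResidualOfTwins
import Summits.BirchSwinnertonDyer.BirchSwinnertonDyer.Theses.PrintX10b
import HarnessLib

/-!
# Crux `BeyondCarrierDepthX10b` (stmt-BirchSwinnertonDyer-23055, `route-BirchSwinnertonDyer-PrintX10b`
# rev 19): what the crux consumes of the Iwasawa theory is ONE per-frame statement — the two-sided
# IMC∘BDP–Waldspurger valuation link `X11b.IMCWaldspurgerOnTreeGoodAt 3 κ 𝔭 γ ι y_K` — and ANY matched
# pair of twins (A : frame ⇒ R, B : frame ⇒ R ⇒ link), for ANY containment package `R`, supplies it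
# (line «twins», lead seat bsd-line-x10b-p1; the PIN-agnostic re-run recipe asked for by plan g9 PIN-1 (R3))

HONEST FRAMING (cell `run/shared/lean/pub/bsd-print-x9/`, D-0131 print tier; LEAD of the registered line
«twins» on crux 23055, D-0154 KEY row 10): THEOREMS ONLY, conditional glue, nothing booked, nothing
closed. Every theorem below has OPEN hypotheses: the per-frame Waldspurger link `hW` (beyond print at
`p = 3` on the `3 ∣ h_K` frames exactly as the twins it abstracts — cell DOSSIER §41.12–41.13, plan g9
FINDING PIN-1), and the cite-only named facts `h331` (Jetchev–Skinner–Wan 2017 Thm. 3.3.1), `hKo`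
(Kolyvagin 1990 Thm. A), `hChaL` (Cha 2005 Thm. 21 / Rmk. 25 lower half, flag `Cha05-Rmk25-remark-only`).
«beyond-print theorem»: NO. BSD is not proved by any of this.

WHY (plan g9 FINDING PIN-1 + RULING, 2026-08-28T05:20Z, (R3) «23055's glue re-run with (A₃^pin,
B₃^pin) — x10b-p1 LEAD»). The landed glue of the line (turnkey T-A
`indexIdentityAt_of_heegnerPoint_of_twins_of_thm331`, ty3 g11; `…_of_sharpTwins`, x10b-p1-w2 p606574;
`…AllFramesOfTwins`, this seat p607041) feeds the A-twin's conclusion — a Howard-containment package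
`∃ jbar D F X, …` — straight into the B-twin's hypothesis and never inspects it. So the glue is
INDEPENDENT of how that package is typed (unpinned rev-19 items 23729/23730, x10b-p1-w2's sharp A₃♯,
or the PINNED items `…Pinned` of the announced PrintX10b rev 20 with `F.Dt = Dt ∧ ¬ 3 ∣ Dt.c`): what
crux 23055 consumes is only the B-twin's OUTPUT at each of its frames,
  `W₃♯` : on every rev-3b X10b Heegner frame (non-CM X10b pair, `K` imaginary quadratic with `d_K` odd
  `≠ -3`, `N_E` and `3` split, `(E/K)[3]` irreducible, Manin-good `Dt`, `P = y_K` the Heegner point,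
  `rank E(K) = 1`, `Ш(E/K)[3^∞]` finite, `P` of infinite order), for every `ι : K → ℚ₃`, anticyclotomic
  `κ` with topological generator `γ`: `X11b.IMCWaldspurgerOnTreeGoodAt 3 κ (inducedPlace ι) γ ι P`
(= route item B₃'s text with its containment hypothesis deleted). This file proves, in the kernel:
* §1 `indexIdentityAt_of_heegnerPoint_of_waldspurgerLink_of_thm331` — the Heegner-index identity over
  `K` (`X11b.IndexIdentityAt W 3 K P`) from `hW` + `h331` + Kolyvagin at the frame (T-A §1 with the pair
  (hA, hB) replaced by hW; everything else verbatim);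
* §2 `heegnerDivisibilityX10b_of_waldspurgerLink_of_namedFacts` — the PARENT J₃ `HeegnerDivisibilityX10b`
  (item 21340) BY NAME from `hW`, `h331`, `hChaL`, `hKo`; `beyondCarrierDepthX10b_of_waldspurgerLink_of_namedFacts`
  — the crux (item 23055) BY NAME from the same four;
* (sibling file `PrintX10bBeyondCarrierOfMatchedTwins.lean`) `waldspurgerLink_of_matchedTwins` — for
  an ARBITRARY package `R W p K κ γ Dt H ιC : Prop`, a matched pair (A♯ : sharp frame ⇒ R, B♯ : sharp
  frame ⇒ R ⇒ link) gives `W₃♯`: the ONE-LINE RE-RUN RECIPE for any future typing of the twins (the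
  rev-19 items, x10b-p1-w2's A₃♯ and the announced pinned items all fit by weakening).
Census consequence (numbers, not adjectives): 23055 ⟸ W₃♯ ∧ {JSW 3.3.1, Kolyvagin Thm. A, Cha Rmk. 25
lower} — 1 open per-frame statement + 3 cite-only facts; no MZ26, no YZ composite, no Jetchev chain,
no Howard containment enters except through whichever B-twin produces W₃♯.

References: [Cha2005] Thm. 21, Rmk. 25; [JetchevSkinnerWan2017] Thm. 3.3.1, §7.4.1; [Kolyvagin1990]
Thm. A; [MatarNekovar2019] Prop. 5.26 (2) (tree theorem); [Darmon2004] Thm. 3.7 (tree theorem);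
[McCallumLMS1991] §5; [GrossLMS1991] §2 (2.2); route file `Theses/PrintX10b.lean` rev 19 (items
21340 / 23055 / 23729 / 23730); plan g9 `plan/findings/PIN-1-unpinned-heegner-family.md` (R0)–(R3).
-/

-- the REGISTERED stub namespace `Summit.BirchSwinnertonDyer.BirchSwinnertonDyer.Cruxes.…` repeats the summit name
set_option linter.dupNamespace false
set_option autoImplicit false

noncomputable section

open scoped Classical MatrixGroups ModularForm

open CongruenceSubgroup WeierstrassCurve NumberField IsDedekindDomain
  Literature.NumberTheory.EllipticCurves Literature.NumberTheory.EllipticCurves.ModularForms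
  Literature.NumberTheory.EllipticCurves.JetchevSkinnerWan2017
  Literature.NumberTheory.EllipticCurves.YanZhu2026
  Summit.BirchSwinnertonDyer.BirchSwinnertonDyer.Theorems.Rank1ResidualX1Defs
  Summit.BirchSwinnertonDyer.Rank1Residual
  Summit.BirchSwinnertonDyer.Rank1Residual.X11b.Three.Koly
  Summit.BirchSwinnertonDyer.Rank1Residual.X11b.KolyvaginBottom
  Summit.BirchSwinnertonDyer.BirchSwinnertonDyer.Rank1Residual
  Summit.BirchSwinnertonDyer.BirchSwinnertonDyer.Theses.PrintX10b

open Literature.NumberTheory.EllipticCurves.Rank1Residual (ClassX10 Surj)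

namespace Summit.BirchSwinnertonDyer.BirchSwinnertonDyer.Cruxes.BeyondCarrierDepthX10b.HowardFrames

/-! ### §1 The Heegner-index identity over `K` from the per-frame Waldspurger link -/

/-- **The Heegner-index identity over `K` (`X11b.IndexIdentityAt W 3 K P`: `2·ord_3 ∏ c_ℓ(E) +
ord_3 #Ш(E/K) = 2·ord_3 [E(K):ℤP]`) at a Manin-unit Heegner datum of a NON-CM X10b pair over a Heegner
field with `3` split, `d_K` odd `< -4`, whose Heegner point `P` has infinite order — GRANTED the
per-frame two-sided IMC∘BDP–Waldspurger link `hW` (statement `W₃♯` of the module docstring: route item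
B₃'s text with its containment hypothesis deleted) and JSW Thm. 3.3.1 (`h331`)**; rank one and finiteness
over `K` by Kolyvagin (`hKo`), (irr_K) by the Matar–Nekovář theorem. Turnkey T-A §1
(`indexIdentityAt_of_heegnerPoint_of_twins_of_thm331`) with the pair (hA, hB) replaced by hW.
[cite: JetchevSkinnerWan2017, Thm. 3.3.1, §7.3.1 (eq:tamK)] [cite: Kolyvagin1990, Thm. A]
[cite: MatarNekovar2019, Prop. 5.26 (2)] [cite: GrossLMS1991, §2 Conj. (2.2)] -/
theorem indexIdentityAt_of_heegnerPoint_of_waldspurgerLink_of_thm331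
    (hW : ∀ (W : WeierstrassCurve ℚ) [W.IsElliptic] [W.IsGloballyMinimal] (p : ℕ) [Fact p.Prime]
    [NeZero (W.conductorNorm ℤ)] (K : Type) [Field K] [NumberField K],
    Literature.NumberTheory.EllipticCurves.Rank1Residual.ClassX10 W p →
    ¬ Literature.NumberTheory.EllipticCurves.Rank1Residual.Surj W 3 → ¬ W.HasCM →
    Literature.NumberTheory.EllipticCurves.IsImaginaryQuadratic K → Odd (NumberField.discr K) →
    NumberField.discr K ≠ -3 →
    Literature.NumberTheory.EllipticCurves.SatisfiesHeegnerHypothesis (W.conductorNorm ℤ) K →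
    Literature.NumberTheory.EllipticCurves.SatisfiesHeegnerHypothesis p K →
    (W.baseChange K).HasIrreducibleModPGaloisRep p →
    ∀ (ι : K →+* ℚ_[p]) (κ : Literature.NumberTheory.EllipticCurves.ZpExtension K p), κ.IsAnticyclotomic →
    ∀ (γ : Field.absoluteGaloisGroup K) [Fact (κ.IsTopGenerator γ)]
      (Dt : Literature.NumberTheory.EllipticCurves.ModularForms.ModularParametrizationData W
        (W.conductorNorm ℤ)), ¬ (p : ℤ) ∣ Dt.c →
    ∀ (H : Literature.NumberTheory.EllipticCurves.HeegnerDatum (W.conductorNorm ℤ) (NumberField.discr K))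
      (ιC : K →+* ℂ) (P : (W.baseChange K).toAffine.Point),
      WeierstrassCurve.Affine.Point.map ιC.toRatAlgHom P =
        Literature.NumberTheory.EllipticCurves.ModularForms.heegnerPointComplex Dt H →
      (W.baseChange K).mordellWeilRank = 1 →
      Finite (AddCommGroup.primaryComponent (W.baseChange K).sha p) → ¬ IsOfFinAddOrder P →
      Summit.BirchSwinnertonDyer.Rank1Residual.X11b.IMCWaldspurgerOnTreeGoodAt p κ
        (Summit.BirchSwinnertonDyer.Rank1Residual.X11b.inducedPlace ι) γ ι P)
    (h331 : thm331_anticyclotomicControl)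
    (W : WeierstrassCurve ℚ) [W.IsElliptic] [W.IsGloballyMinimal] [NeZero (W.conductorNorm ℤ)]
    (p : ℕ) [Fact p.Prime] (hX : ClassX10 W p) (hns : ¬ Surj W 3) (hcm : ¬ W.HasCM)
    (K : Type) [Field K] [NumberField K] (hKo : kolyvagin (W.conductorNorm ℤ) W K)
    (hK : IsImaginaryQuadratic K) (hodd : Odd (NumberField.discr K)) (hlt : NumberField.discr K < -4)
    (hHN : SatisfiesHeegnerHypothesis (W.conductorNorm ℤ) K) (hHp : SatisfiesHeegnerHypothesis p K)
    (Dt : ModularParametrizationData W (W.conductorNorm ℤ))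
    (H : HeegnerDatum (W.conductorNorm ℤ) (NumberField.discr K)) (ιC : K →+* ℂ)
    (P : (W.baseChange K).toAffine.Point)
    (hP : WeierstrassCurve.Affine.Point.map ιC.toRatAlgHom P = heegnerPointComplex Dt H)
    (hPinf : ¬ IsOfFinAddOrder P) (hc : ¬ (p : ℤ) ∣ Dt.c) : X11b.IndexIdentityAt W p K P := by
  obtain ⟨hp3, hord, hirr, -⟩ := id hX
  subst hp3
  have hpP : (3 : ℕ).Prime := Fact.out
  have hp2 : (3 : ℕ) ≠ 2 := by norm_num
  have h3 : NumberField.discr K ≠ -3 := by omega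
  -- rank one and finiteness over `K` (Kolyvagin, from the non-torsion Heegner point)
  obtain ⟨hrk, hshaK⟩ := hKo hK hHN ⟨Dt, H, ιC, hP⟩ hPinf
  haveI : Finite (W.baseChange K).sha := hshaK
  have hfinp : Finite (AddCommGroup.primaryComponent (W.baseChange K).sha 3) :=
    Finite.of_injective _ Subtype.val_injective
  -- (irr_K) at this field (Matar–Nekovář Prop. 5.26 (2), a tree theorem)
  have hirrK : (W.baseChange K).HasIrreducibleModPGaloisRep 3 :=
    MatarNekovar2019.prop526_hasIrreducibleModPGaloisRep_baseChange_holds W K hK.1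
      (Literature.SatisfiesHeegnerHypothesis.coprime_discr hK.1 hHN) 3 hp2 hirr
  -- the anticyclotomic datum and the embedding at a prime above `3`
  obtain ⟨κ, γ, 𝔭, hκ, hγ, h𝔭⟩ := X11b.exists_anticyclotomic_generator_prime (p := 3) hK
  haveI : Fact (κ.IsTopGenerator γ) := ⟨hγ⟩
  have hsplit : X11b.SplitsIn K 3 := hHp 3 Fact.out (dvd_refl 3)
  obtain ⟨he, hf⟩ := X11b.degreeOne_of_splitsIn hK.1 hsplit h𝔭
  set ι : K →+* ℚ_[3] := X11b.embAt K 3 𝔭 h𝔭 he hf with hι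
  have hCTL : X11b.ControlOnTreeGoodAt 3 κ (X11b.inducedPlace ι) γ ι P :=
    X11b.controlOnTreeGoodAt_of_thm331_of_inducedPlace h331 le_rfl hord.1 hK hHp rfl hHN hirrK ι
      κ hκ γ hrk hfinp P hPinf
  -- the two-sided link at the frame (the ONLY Iwasawa-theoretic input)
  have hIW : X11b.IMCWaldspurgerOnTreeGoodAt 3 κ (X11b.inducedPlace ι) γ ι P :=
    hW W 3 K hX hns hcm hK hodd h3 hHN hHp hirrK ι κ hκ γ Dt hc H ιC P hP hrk hfinp hPinf
  exact X11b.indexIdentityAt_of_onTreeGoodLinks_of_allSplit hK rfl hHN hIW hCTL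

/-! ### §2 The parent J₃ (item 21340) and the crux (item 23055) BY NAME from the per-frame link -/

/-- **J₃ — `HeegnerDivisibilityX10b` (stmt-BirchSwinnertonDyer-21340) BY NAME, GRANTED the per-frame
Waldspurger link `hW` (`W₃♯`) and THREE named facts** (`h331` JSW Thm. 3.3.1, `hChaL` Cha Rmk. 25 lower
half, `hKo` Kolyvagin Thm. A): on every rev-3b X10b frame, every depth `s ≤ ord_3 ∏ c_q(E)`, ANY class
number, every derived Heegner point on Kolyvagin primes of index `≥ s` is `3^s`-divisible (bound `B = 4`).
Proof = turnkey T-A §2 verbatim over §1: `ord_3 [E(K):ℤy_K] = M₀` (McCallum Lemma 5.1 bookkeeping), a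
non-divisible `P_n` at depth `s` is a level-`(s-1)` certificate ⇒ `2(M₀ - s + 1) ≤ ord_3 #Ш(E/K) =
2M₀ - 2t` (Cha's lower half against the identity) — absurd. Conditional glue; beyond-print theorem: no.
[cite: Cha2005, Thm. 21 and Rmk. 25] [cite: JetchevSkinnerWan2017, Thm. 3.3.1] [cite: Kolyvagin1990, Thm. A]
[cite: McCallumLMS1991, §5 (Lemma 5.1)] [cite: Darmon2004, Thm. 3.7] -/
theorem heegnerDivisibilityX10b_of_waldspurgerLink_of_namedFacts
    (h331 : thm331_anticyclotomicControl)
    (hChaL : Cha2005.rmk25_pow_dvd_card_sha_primary_of_certificate)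
    (hKo : ∀ (N : ℕ) [NeZero N] (W : WeierstrassCurve ℚ) (K : Type) [Field K] [NumberField K],
      kolyvagin N W K)
    (hW : ∀ (W : WeierstrassCurve ℚ) [W.IsElliptic] [W.IsGloballyMinimal] (p : ℕ) [Fact p.Prime]
    [NeZero (W.conductorNorm ℤ)] (K : Type) [Field K] [NumberField K],
    Literature.NumberTheory.EllipticCurves.Rank1Residual.ClassX10 W p →
    ¬ Literature.NumberTheory.EllipticCurves.Rank1Residual.Surj W 3 → ¬ W.HasCM →
    Literature.NumberTheory.EllipticCurves.IsImaginaryQuadratic K → Odd (NumberField.discr K) →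
    NumberField.discr K ≠ -3 →
    Literature.NumberTheory.EllipticCurves.SatisfiesHeegnerHypothesis (W.conductorNorm ℤ) K →
    Literature.NumberTheory.EllipticCurves.SatisfiesHeegnerHypothesis p K →
    (W.baseChange K).HasIrreducibleModPGaloisRep p →
    ∀ (ι : K →+* ℚ_[p]) (κ : Literature.NumberTheory.EllipticCurves.ZpExtension K p), κ.IsAnticyclotomic →
    ∀ (γ : Field.absoluteGaloisGroup K) [Fact (κ.IsTopGenerator γ)]
      (Dt : Literature.NumberTheory.EllipticCurves.ModularForms.ModularParametrizationData W
        (W.conductorNorm ℤ)), ¬ (p : ℤ) ∣ Dt.c →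
    ∀ (H : Literature.NumberTheory.EllipticCurves.HeegnerDatum (W.conductorNorm ℤ) (NumberField.discr K))
      (ιC : K →+* ℂ) (P : (W.baseChange K).toAffine.Point),
      WeierstrassCurve.Affine.Point.map ιC.toRatAlgHom P =
        Literature.NumberTheory.EllipticCurves.ModularForms.heegnerPointComplex Dt H →
      (W.baseChange K).mordellWeilRank = 1 →
      Finite (AddCommGroup.primaryComponent (W.baseChange K).sha p) → ¬ IsOfFinAddOrder P →
      Summit.BirchSwinnertonDyer.Rank1Residual.X11b.IMCWaldspurgerOnTreeGoodAt p κ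
        (Summit.BirchSwinnertonDyer.Rank1Residual.X11b.inducedPlace ι) γ ι P) :
    HeegnerDivisibilityX10b := by
  intro W _ _ _ p _ hX hns hcm _
  obtain ⟨hp3, hordW, hirr, -⟩ := id hX
  subst hp3
  refine ⟨4, ?_⟩
  intro K _ _ Dt β ι hK hBK hd8 hHN hHp hβ hc d₁ hd₁ s hs n d hn hℓ
  -- Shimura reciprocity at conductor `1`: a tree THEOREM (Darmon Thm. 3.7)
  have hrec : ∀ (N : ℕ) [NeZero N] (W : WeierstrassCurve ℚ) (K : Type) [Field K] [NumberField K],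
      heegnerPointOfConductor_one_galoisConj N W K :=
    fun N _ W K _ _ ↦ heegnerPointOfConductor_one_galoisConj_holds N W K
  have hodd : Odd (NumberField.discr K) := Int.odd_iff.mpr (by omega)
  have hpP : (3 : ℕ).Prime := Fact.out
  have hp2 : (3 : ℕ) ≠ 2 := by norm_num
  have hneg : NumberField.discr K < 0 := IsImaginaryQuadratic.discr_neg hK
  have hlt : NumberField.discr K < -4 := by omega
  have h3 : NumberField.discr K ≠ -3 := by omega
  have h4 : NumberField.discr K ≠ -4 := by omega
  have hpd : ¬ ((3 : ℕ) : ℤ) ∣ NumberField.discr K :=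
    Literature.SatisfiesHeegnerHypothesis.not_dvd_discr hK.1 hHp hpP (dvd_refl 3)
  have hpN : ¬ 3 ∣ W.conductorNorm ℤ := fun h ↦
    (W.dvd_conductorNorm_iff_not_hasGoodReductionAtPrime 3).mp h hordW.1
  have hpN2 : ¬ 3 ^ 2 ∣ W.conductorNorm ℤ := fun h ↦ hpN (dvd_trans (dvd_pow_self 3 two_ne_zero) h)
  -- depth `0` is trivial
  rcases Nat.eq_zero_or_pos s with rfl | hs1
  · exact ⟨d.derivedPoint, by rw [pow_zero, Nat.cast_one, one_zsmul]⟩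
  -- the oriented Heegner datum of the frame and THE Heegner point `y_K ∈ E(K)`
  obtain ⟨H, hHβ⟩ := exists_heegnerDatum (W.conductorNorm ℤ) hneg hβ
  obtain ⟨P, hP⟩ := heegnerPointComplex_mem_range_map_holds (W.conductorNorm ℤ) W K hK hHN Dt H ι
  have hPd : d₁.toGeomPoints d₁.derivedPoint = toGeomPoints (W.baseChange K) P :=
    toGeomPoints_derivedPoint_one_eq (hrec _ W K) hK hHN hP d₁ hHβ
  have hPinf : ¬ IsOfFinAddOrder P := fun hfin ↦
    hd₁ ((isOfFinAddOrder_derivedPoint_one_iff (hrec _ W K) hK hHN hP d₁ hHβ).mpr hfin)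
  -- the identity over `K` at this frame, ANY class number (§1, from the per-frame link)
  have hid := indexIdentityAt_of_heegnerPoint_of_waldspurgerLink_of_thm331 hW h331 W 3 hX hns hcm K
    (hKo _ W K) hK hodd hlt hHN hHp Dt H ι P hP hPinf hc
  -- rank one and finiteness over `K` (Kolyvagin), no `3`-torsion (irreducibility)
  obtain ⟨hrank, hshaK⟩ := hKo (W.conductorNorm ℤ) W K hK hHN ⟨Dt, H, ι, hP⟩ hPinf
  haveI : Finite (W.baseChange K).sha := hshaK
  haveI hfinp : Finite (AddCommGroup.primaryComponent (W.baseChange K).sha 3) :=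
    Finite.of_injective _ Subtype.val_injective
  have hbot := torsionBy_eq_bot_of_isImaginaryQuadratic_of_hasIrreducibleModPGaloisRep W K hK hpP hirr
  have hiv : ∀ x : (W.baseChange K).toAffine.Point, 3 • x = 0 → x = 0 := fun x hx ↦ by
    have hmem : x ∈ AddSubgroup.torsionBy (W.baseChange K).toAffine.Point (((3 : ℕ) : ℕ) : ℤ) := by
      rw [mem_torsionBy_iff, natCast_zsmul]
      exact hx
    rw [hbot] at hmem
    exact hmem
  -- the exponent `3^{M₀} ∥ y_K` in `E(K)` and `ord_3 [E(K):ℤy_K] = M₀` (McCallum Lemma 5.1)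
  haveI : Module.Finite ℤ (W.baseChange K).toAffine.Point := (W.baseChange K).module_finite_point_holds
  obtain ⟨M₀, x₀, hx₀, hmax⟩ := exists_pow_smul_eq_and_forall_ne hPinf (p := 3) hpP.two_le
  have hdiv : ∃ Q : (W.baseChange K).toAffine.Point, ((3 ^ M₀ : ℕ) : ℤ) • Q = P :=
    ⟨x₀, by rw [natCast_zsmul]; exact hx₀⟩
  have hndiv : ¬ ∃ Q : (W.baseChange K).toAffine.Point, ((3 ^ (M₀ + 1) : ℕ) : ℤ) • Q = P := by
    rintro ⟨Q, hQ⟩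
    exact hmax Q (by rw [← natCast_zsmul]; exact hQ)
  haveI : Finite (AddCommGroup.torsion (W.baseChange K).toAffine.Point) :=
    WeierstrassCurve.finite_torsion_point (W := W.baseChange K)
  obtain ⟨c, Q, hcQ, hcker⟩ := X11b.RankOne.exists_coord_of_mordellWeilRank_eq_one (W.baseChange K) hrank
  have hidx : padicValNat 3 (AddSubgroup.zmultiples P).index = M₀ :=
    padicValNat_index_zmultiples_eq_of_divisibility c Q hcQ hcker hiv P hdiv hndiv
  -- suppose `P_n ∉ 3^s E(K_n)`: a level-`(s-1)` certificate; Cha's LOWER half bounds `#Ш` from below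
  by_contra hQ
  have hcert := hChaL W hcm K hK h3 h4 hHN 3 hp2 hpd hpN2 hirr Dt β ι d₁ P hPd hPinf M₀
    hdiv hndiv n (s - 1) d hn
    (fun ℓ hℓ' ↦ ⟨(hℓ ℓ hℓ').1, by have := (hℓ ℓ hℓ').2; omega⟩)
    (by rw [Nat.sub_add_cancel hs1]; exact hQ)
  have hle : 2 * (M₀ - (s - 1)) ≤
      padicValNat 3 (Nat.card (AddCommGroup.primaryComponent (W.baseChange K).sha 3)) :=
    (padicValNat_dvd_iff_le Nat.card_pos.ne').mp hcert
  rw [padicValNat_card_addPrimaryComponent (A := (W.baseChange K).sha) 3] at hle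
  -- the identity: `2t + ord_3 #Ш(E/K) = 2M₀`
  unfold X11b.IndexIdentityAt at hid
  rw [WeierstrassCurve.shaOrder, hidx] at hid
  omega

/-- **Crux `BeyondCarrierDepthX10b` (item 23055) BY NAME from the per-frame Waldspurger link `hW`
(`W₃♯`) and the three named facts** — the parent of §2 weakened by the (idle) beyond-carrier clause.
The crux is thereby REDUCED in the kernel to ONE open per-frame statement modulo {JSW 3.3.1, Kolyvagin
Thm. A, Cha Rmk. 25 lower}; it is not closed (W₃♯ is beyond print at `p = 3` on the `3 ∣ h_K` frames).
[cite: Cha2005, Thm. 21 and Rmk. 25] [cite: JetchevSkinnerWan2017, Thm. 3.3.1] [cite: Kolyvagin1990, Thm. A] -/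
theorem beyondCarrierDepthX10b_of_waldspurgerLink_of_namedFacts
    (h331 : thm331_anticyclotomicControl)
    (hChaL : Cha2005.rmk25_pow_dvd_card_sha_primary_of_certificate)
    (hKo : ∀ (N : ℕ) [NeZero N] (W : WeierstrassCurve ℚ) (K : Type) [Field K] [NumberField K],
      kolyvagin N W K)
    (hW : ∀ (W : WeierstrassCurve ℚ) [W.IsElliptic] [W.IsGloballyMinimal] (p : ℕ) [Fact p.Prime]
    [NeZero (W.conductorNorm ℤ)] (K : Type) [Field K] [NumberField K],
    Literature.NumberTheory.EllipticCurves.Rank1Residual.ClassX10 W p →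
    ¬ Literature.NumberTheory.EllipticCurves.Rank1Residual.Surj W 3 → ¬ W.HasCM →
    Literature.NumberTheory.EllipticCurves.IsImaginaryQuadratic K → Odd (NumberField.discr K) →
    NumberField.discr K ≠ -3 →
    Literature.NumberTheory.EllipticCurves.SatisfiesHeegnerHypothesis (W.conductorNorm ℤ) K →
    Literature.NumberTheory.EllipticCurves.SatisfiesHeegnerHypothesis p K →
    (W.baseChange K).HasIrreducibleModPGaloisRep p →
    ∀ (ι : K →+* ℚ_[p]) (κ : Literature.NumberTheory.EllipticCurves.ZpExtension K p), κ.IsAnticyclotomic →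
    ∀ (γ : Field.absoluteGaloisGroup K) [Fact (κ.IsTopGenerator γ)]
      (Dt : Literature.NumberTheory.EllipticCurves.ModularForms.ModularParametrizationData W
        (W.conductorNorm ℤ)), ¬ (p : ℤ) ∣ Dt.c →
    ∀ (H : Literature.NumberTheory.EllipticCurves.HeegnerDatum (W.conductorNorm ℤ) (NumberField.discr K))
      (ιC : K →+* ℂ) (P : (W.baseChange K).toAffine.Point),
      WeierstrassCurve.Affine.Point.map ιC.toRatAlgHom P =
        Literature.NumberTheory.EllipticCurves.ModularForms.heegnerPointComplex Dt H →
      (W.baseChange K).mordellWeilRank = 1 →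
      Finite (AddCommGroup.primaryComponent (W.baseChange K).sha p) → ¬ IsOfFinAddOrder P →
      Summit.BirchSwinnertonDyer.Rank1Residual.X11b.IMCWaldspurgerOnTreeGoodAt p κ
        (Summit.BirchSwinnertonDyer.Rank1Residual.X11b.inducedPlace ι) γ ι P) :
    BeyondCarrierDepthX10b := by
  intro W _ _ _ p _ hX hns hcm hr
  obtain ⟨B, hJB⟩ := heegnerDivisibilityX10b_of_waldspurgerLink_of_namedFacts h331 hChaL hKo hW W p
    hX hns hcm hr
  refine ⟨B, ?_⟩
  intro K _ _ Dt β ι hK hBK hd8 hHN hHp hβ hc d₁ hd₁ s _ hs n d hn hℓ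
  exact hJB K Dt β ι hK hBK hd8 hHN hHp hβ hc d₁ hd₁ s hs n d hn hℓ


end Summit.BirchSwinnertonDyer.BirchSwinnertonDyer.Cruxes.BeyondCarrierDepthX10b.HowardFrames

end
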